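import Mathlib
import Summits.MatrixMultiplication.MatrixMultiplication.Theorems.NilpotentLieHostsNilpotentThresholdDesignsStubRecenter
import Summits.MatrixMultiplication.MatrixMultiplication.Theorems.NilpotentLieHostsNilpotentThresholdDesignsCommutingMiddleCap

/-!
# `NilpotentThresholdDesigns` (stmt-MatrixMultiplication-7720) — the PACKING CEILING `(|X||Y||Z|)² ≤ (s+1)^(3D)`

The crux `NilpotentThresholdDesigns` (route `NilpotentLieHosts`) asks, at one `d ≥ 3` and for every `δ > 0`, for
designs `X, Y, Z ⊂ U_d(ℤ)` with separating polynomials of `(j−i)`-weighted degree `≤ s` and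
`|X||Y||Z| ≥ s^((3/4)d(d−1) − δ) = s^((3/2)D − δ)`, `D = d(d−1)/2`.  This file proves that `(3/2)D` is the absolute
ceiling of the framework — the "flattening"/packing bound every refuter of the route quoted informally:

**Theorem (`card_sq_le_pow_of_separating`).** For finite sets `X, Y, Z` of upper unitriangular elements of `SL(d, ℤ)`
admitting separating polynomials of weighted degree `≤ s` for every target (literally the third clause of the crux),

  `(|X| · |Y| · |Z|)² ≤ ((s + 1)^(d(d−1)/2))³`,  i.e.  `|X||Y||Z| ≤ (s+1)^((3/2)D)`.

So the crux demands designs saturating this bound up to `s^(−δ)` for every `δ` — "perfect" designs in one fixed group.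

*Proof.* Three dualities inside the space `F` of weighted-degree-`≤ s` polynomial functions on the unitriangular group
(dimension `≤ (s+1)^D`, stable under unitriangular two-sided translation by the landed `stub_recenter`):
`p_{x₀,z₀}` is dual to the points `x z⁻¹` (`|X||Z| ≤ dim F`), the right translates `m ↦ p_{x₀,z₀}(m y' z₀⁻¹)` are dual
to the points `x y⁻¹` (`|X||Y| ≤ dim F`), and the left translates `m ↦ p_{x₀,z₀}(x₀ y⁻¹ m)` are dual to the points
`y' z⁻¹` (`|Y||Z| ≤ dim F`); multiply.  The abstract form (`card_mul_card_le_finrank_of_separating`) holds in any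
group for any finite-dimensional function space with the two translation stabilities (CohnUmans2003 §2 packing
bound `|X||Y||Z| ≤ |G|^(3/2)`, transplanted to degree-budgeted function spaces; BlasiakCohnGrochowPrattUmans2024
Rem 1.3 / §2.3).
-/

set_option linter.dupNamespace false

namespace Summit.MatrixMultiplication.MatrixMultiplication.Theorems.NilpotentThresholdDesigns

open scoped BigOperators

/-- Duality gives independence: if `v j (pt i) = [j = i]` for a family `v : ι → F` of functions and points
`pt : ι → G`, then `|ι| ≤ finrank F`. [folklore] -/
theorem card_le_finrank_of_dual {G : Type*} {ι : Type*} [Fintype ι] [DecidableEq ι]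
    (F : Submodule ℂ (G → ℂ)) [FiniteDimensional ℂ F] (v : ι → F) (pt : ι → G)
    (hdual : ∀ i j : ι, (v j : G → ℂ) (pt i) = if j = i then 1 else 0) :
    Fintype.card ι ≤ Module.finrank ℂ F := by
  have hli : LinearIndependent ℂ v := by
    rw [linearIndependent_iff']
    intro s g hsum i hi
    have heval := congrArg (fun f : F => (f : G → ℂ) (pt i)) hsum
    simp only [Submodule.coe_sum, Submodule.coe_smul, Finset.sum_apply, Pi.smul_apply, smul_eq_mul,
      Submodule.coe_zero, Pi.zero_apply] at heval
    simp_rw [hdual i] at heval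
    simpa [Finset.sum_ite_eq', hi] using heval
  exact hli.fintype_card_le_finrank

/-- **Packing bound, abstract form.**  Let `F` be a finite-dimensional space of complex functions on a group `G`,
stable under the left translations `m ↦ x₀ y⁻¹ m` and the right translations `m ↦ m y' z₀⁻¹` (`x₀ ∈ X`, `y, y' ∈ Y`,
`z₀ ∈ Z`), and let `X, Y, Z` admit separating functions in `F` for every target (BCGPU24 Def 2.1).  Then
`(|X|·|Y|·|Z|)² ≤ (finrank F)³` — the packing bound `|X||Y||Z| ≤ |G|^(3/2)` of CohnUmans2003 §2 transplanted to
degree-budgeted function spaces. [folklore] -/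
theorem card_sq_le_finrank_cube_of_separating {G : Type*} [Group G] [DecidableEq G]
    (F : Submodule ℂ (G → ℂ)) [FiniteDimensional ℂ F] (X Y Z : Finset G)
    (hL : ∀ x₀ ∈ X, ∀ y ∈ Y, ∀ f ∈ F, (fun m => f (x₀ * y⁻¹ * m)) ∈ F)
    (hR : ∀ y' ∈ Y, ∀ z₀ ∈ Z, ∀ f ∈ F, (fun m => f (m * (y' * z₀⁻¹))) ∈ F)
    (hsep : ∀ x₀ ∈ X, ∀ z₀ ∈ Z, ∃ p ∈ F, ∀ x ∈ X, ∀ y ∈ Y, ∀ y' ∈ Y, ∀ z ∈ Z,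
      p (x * y⁻¹ * y' * z⁻¹) = if x = x₀ ∧ y = y' ∧ z = z₀ then 1 else 0) :
    (X.card * Y.card * Z.card) ^ 2 ≤ (Module.finrank ℂ F) ^ 3 := by
  -- empty cases are trivial
  rcases X.eq_empty_or_nonempty with hX | ⟨x₁, hx₁⟩
  · simp [hX]
  rcases Y.eq_empty_or_nonempty with hY | ⟨y₁, hy₁⟩
  · simp [hY]
  rcases Z.eq_empty_or_nonempty with hZ | ⟨z₁, hz₁⟩
  · simp [hZ]
  choose p hpF hp using hsep
  set n := Module.finrank ℂ F with hn
  -- (a) |X||Z| ≤ n : `p_{x₀,z₀}` dual to the points `x z⁻¹` (take `y = y' = y₁`)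
  have hXZ : X.card * Z.card ≤ n := by
    have h := card_le_finrank_of_dual F
      (fun j : ↥X × ↥Z => ⟨p j.1 j.1.2 j.2 j.2.2, hpF j.1 j.1.2 j.2 j.2.2⟩)
      (fun i : ↥X × ↥Z => (i.1 : G) * y₁⁻¹ * y₁ * (i.2 : G)⁻¹) ?_
    · simpa [Fintype.card_prod, Fintype.card_coe] using h
    rintro ⟨x, z⟩ ⟨x₀, z₀⟩
    change p x₀ x₀.2 z₀ z₀.2 ((x : G) * y₁⁻¹ * y₁ * (z : G)⁻¹) = _
    rw [hp x₀ x₀.2 z₀ z₀.2 x x.2 y₁ hy₁ y₁ hy₁ z z.2]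
    by_cases h : (x : G) = x₀ ∧ (z : G) = z₀
    · rw [if_pos ⟨h.1, rfl, h.2⟩, if_pos]
      ext <;> simp [h.1, h.2]
    · rw [if_neg (fun h' => h ⟨h'.1, h'.2.2⟩), if_neg]
      rintro ⟨rfl⟩
      exact h ⟨rfl, rfl⟩
  -- (b) |X||Y| ≤ n : right translates `m ↦ p_{x₀,z₁}(m y' z₁⁻¹)` dual to the points `x y⁻¹`
  have hXY : X.card * Y.card ≤ n := by
    have h := card_le_finrank_of_dual F
      (fun j : ↥X × ↥Y => ⟨fun m => p j.1 j.1.2 z₁ hz₁ (m * ((j.2 : G) * z₁⁻¹)),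
        hR j.2 j.2.2 z₁ hz₁ _ (hpF j.1 j.1.2 z₁ hz₁)⟩)
      (fun i : ↥X × ↥Y => (i.1 : G) * (i.2 : G)⁻¹) ?_
    · simpa [Fintype.card_prod, Fintype.card_coe] using h
    rintro ⟨x, y⟩ ⟨x₀, y'⟩
    change p x₀ x₀.2 z₁ hz₁ ((x : G) * (y : G)⁻¹ * ((y' : G) * z₁⁻¹)) = _
    rw [show (x : G) * (y : G)⁻¹ * ((y' : G) * z₁⁻¹) = x * (y : G)⁻¹ * y' * z₁⁻¹ by group,
      hp x₀ x₀.2 z₁ hz₁ x x.2 y y.2 y' y'.2 z₁ hz₁]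
    by_cases h : (x : G) = x₀ ∧ (y : G) = y'
    · rw [if_pos ⟨h.1, h.2, rfl⟩, if_pos]
      ext <;> simp [h.1, h.2]
    · rw [if_neg (fun h' => h ⟨h'.1, h'.2.1⟩), if_neg]
      rintro ⟨rfl⟩
      exact h ⟨rfl, rfl⟩
  -- (c) |Y||Z| ≤ n : left translates `m ↦ p_{x₁,z₀}(x₁ y⁻¹ m)` dual to the points `y' z⁻¹`
  have hYZ : Y.card * Z.card ≤ n := by
    have h := card_le_finrank_of_dual F
      (fun j : ↥Y × ↥Z => ⟨fun m => p x₁ hx₁ j.2 j.2.2 (x₁ * (j.1 : G)⁻¹ * m),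
        hL x₁ hx₁ j.1 j.1.2 _ (hpF x₁ hx₁ j.2 j.2.2)⟩)
      (fun i : ↥Y × ↥Z => (i.1 : G) * (i.2 : G)⁻¹) ?_
    · simpa [Fintype.card_prod, Fintype.card_coe] using h
    rintro ⟨y', z⟩ ⟨y, z₀⟩
    change p x₁ hx₁ z₀ z₀.2 (x₁ * (y : G)⁻¹ * ((y' : G) * (z : G)⁻¹)) = _
    rw [show x₁ * (y : G)⁻¹ * ((y' : G) * (z : G)⁻¹) = x₁ * (y : G)⁻¹ * y' * (z : G)⁻¹ by group,
      hp x₁ hx₁ z₀ z₀.2 x₁ hx₁ y y.2 y' y'.2 z z.2]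
    by_cases h : (y : G) = y' ∧ (z : G) = z₀
    · rw [if_pos ⟨rfl, h.1, h.2⟩, if_pos]
      ext <;> simp [h.1, h.2]
    · rw [if_neg (fun h' => h ⟨h'.2.1, h'.2.2⟩), if_neg]
      rintro ⟨rfl⟩
      exact h ⟨rfl, rfl⟩
  -- multiply the three bounds
  calc (X.card * Y.card * Z.card) ^ 2
      = (X.card * Z.card) * (X.card * Y.card) * (Y.card * Z.card) := by ring
    _ ≤ n * n * n := Nat.mul_le_mul (Nat.mul_le_mul hXZ hXY) hYZ
    _ = n ^ 3 := by ring

open MvPolynomial in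
/-- **Packing ceiling in `U_d(ℤ)`** (the crux's vocabulary).  If finite sets `X, Y, Z` of upper unitriangular
elements of `SL(d, ℤ)` admit separating polynomials of `(j−i)`-weighted degree `≤ s` for every target (literally the
third clause of `NilpotentThresholdDesigns`), then `(|X|·|Y|·|Z|)² ≤ ((s+1)^(d(d−1)/2))³`, i.e.
`|X||Y||Z| ≤ (s+1)^((3/2)D)`: the crux's threshold `s^((3/2)D − δ)` is the ceiling of the whole framework up to the
factor `s^δ`. -/
theorem card_sq_le_pow_of_separating :
    ∀ (d s : ℕ) (X Y Z : Finset (Matrix.SpecialLinearGroup (Fin d) ℤ)),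
    (∀ g ∈ X ∪ Y ∪ Z, ∀ i j : Fin d, j ≤ i → (g : Matrix (Fin d) (Fin d) ℤ) i j = if i = j then 1 else 0) →
    (∀ x₀ ∈ X, ∀ z₀ ∈ Z, ∃ p : MvPolynomial (Fin d × Fin d) ℂ,
      MvPolynomial.weightedTotalDegree (fun ij : Fin d × Fin d => (ij.2 : ℕ) - ij.1) p ≤ s ∧
      ∀ x ∈ X, ∀ y ∈ Y, ∀ y' ∈ Y, ∀ z ∈ Z, MvPolynomial.eval (fun ij : Fin d × Fin d =>
        (((x * y⁻¹ * y' * z⁻¹ : Matrix.SpecialLinearGroup (Fin d) ℤ) : Matrix (Fin d) (Fin d) ℤ) ij.1 ij.2 : ℂ)) p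
          = if x = x₀ ∧ y = y' ∧ z = z₀ then 1 else 0) →
    (X.card * Y.card * Z.card) ^ 2 ≤ ((s + 1) ^ (d * (d - 1) / 2)) ^ 3 := by
  intro d s X Y Z hU hsep
  classical
  -- the unitriangular subgroup `U` and the three sets inside it
  let U : Subgroup (Matrix.SpecialLinearGroup (Fin d) ℤ) :=
    { carrier := {g | ∀ i j : Fin d, j ≤ i → (g : Matrix (Fin d) (Fin d) ℤ) i j = if i = j then 1 else 0}
      mul_mem' := fun hg hh => unitriangular_mul hg hh
      one_mem' := unitriangular_one
      inv_mem' := fun hg => unitriangular_inv hg }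
  have hXU : ∀ x ∈ X, x ∈ U := fun x hx => hU x (Finset.mem_union_left _ (Finset.mem_union_left _ hx))
  have hYU : ∀ y ∈ Y, y ∈ U := fun y hy => hU y (Finset.mem_union_left _ (Finset.mem_union_right _ hy))
  have hZU : ∀ z ∈ Z, z ∈ U := fun z hz => hU z (Finset.mem_union_right _ hz)
  let X' : Finset U := X.subtype (· ∈ U)
  let Y' : Finset U := Y.subtype (· ∈ U)
  let Z' : Finset U := Z.subtype (· ∈ U)
  have hX' : X'.card = X.card := by rw [Finset.card_subtype, Finset.filter_true_of_mem hXU]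
  have hY' : Y'.card = Y.card := by rw [Finset.card_subtype, Finset.filter_true_of_mem hYU]
  have hZ' : Z'.card = Z.card := by rw [Finset.card_subtype, Finset.filter_true_of_mem hZU]
  -- points and the evaluation map into functions on `U`
  let pt : U → Fin d × Fin d → ℂ := fun u ij =>
    (((u : Matrix.SpecialLinearGroup (Fin d) ℤ) : Matrix (Fin d) (Fin d) ℤ) ij.1 ij.2 : ℂ)
  let evL : MvPolynomial (Fin d × Fin d) ℂ →ₗ[ℂ] (U → ℂ) :=
    LinearMap.pi fun u => (MvPolynomial.aeval (pt u)).toLinearMap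
  have evL_apply : ∀ p u, evL p u = MvPolynomial.eval (pt u) p := fun p u => rfl
  let w : Fin d × Fin d → ℕ := fun ij => (ij.2 : ℕ) - ij.1
  -- the function space `F = {u ↦ p(u) : wdeg p ≤ s}` and a finite spanning family of monomial functions
  let S : Set (U → ℂ) := {f | ∃ p : MvPolynomial (Fin d × Fin d) ℂ, weightedTotalDegree w p ≤ s ∧ f = evL p}
  let F : Submodule ℂ (U → ℂ) := Submodule.span ℂ S
  let fam : ({ij : Fin d × Fin d // ij.1 < ij.2} → Fin (s + 1)) → (U → ℂ) := fun e =>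
    evL (monomial (Finsupp.equivFunOnFinite.symm fun ij : Fin d × Fin d =>
      if h : ij.1 < ij.2 then (e ⟨ij, h⟩ : ℕ) else 0) 1)
  let F₀ : Submodule ℂ (U → ℂ) := Submodule.span ℂ (Set.range fam)
  haveI : FiniteDimensional ℂ F₀ := FiniteDimensional.span_of_finite ℂ (Set.finite_range fam)
  have hmono : ∀ (m : Fin d × Fin d →₀ ℕ) (c : ℂ), Finsupp.weight w m ≤ s → evL (monomial m c) ∈ F₀ := by
    intro m c hm
    have hpt : ∀ u : U, MvPolynomial.eval (pt u) (monomial m c) =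
        if ∀ ij ∈ m.support, ¬ ij.2 < ij.1 then
          MvPolynomial.eval (pt u) (monomial (m.filter fun ij => ij.1 < ij.2) c) else 0 := by
      intro u
      refine eval_monomial_unitriangular (pt u) (fun i => ?_) (fun i j hji => ?_) m c
      · show (((u : Matrix.SpecialLinearGroup (Fin d) ℤ) : Matrix (Fin d) (Fin d) ℤ) i i : ℂ) = 1
        rw [u.2 i i le_rfl, if_pos rfl, Int.cast_one]
      · show (((u : Matrix.SpecialLinearGroup (Fin d) ℤ) : Matrix (Fin d) (Fin d) ℤ) i j : ℂ) = 0
        rw [u.2 i j hji.le, if_neg (ne_of_gt hji), Int.cast_zero]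
    by_cases hcond : ∀ ij ∈ m.support, ¬ ij.2 < ij.1
    · let m' : Fin d × Fin d →₀ ℕ := m.filter fun ij => ij.1 < ij.2
      have hm' : ∀ ij, m' ij ≤ s := by
        rintro ⟨i, j⟩
        by_cases hij : i < j
        · have hw : w (i, j) ≠ 0 := by
            show (j : ℕ) - i ≠ 0
            have := Fin.lt_def.mp hij
            omega
          calc m' (i, j) = m (i, j) :=
                Finsupp.filter_apply_pos (fun ij : Fin d × Fin d => ij.1 < ij.2) m (a := (i, j)) hij
            _ ≤ Finsupp.weight w m := Finsupp.le_weight w hw m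
            _ ≤ s := hm
        · show (m.filter fun ij : Fin d × Fin d => ij.1 < ij.2) (i, j) ≤ s
          rw [Finsupp.filter_apply_neg (fun ij : Fin d × Fin d => ij.1 < ij.2) m (a := (i, j)) hij]
          exact Nat.zero_le _
      let e : {ij : Fin d × Fin d // ij.1 < ij.2} → Fin (s + 1) := fun ij =>
        ⟨m' ij.1, Nat.lt_succ_of_le (hm' ij.1)⟩
      have hme : (Finsupp.equivFunOnFinite.symm fun ij : Fin d × Fin d =>
          if h : ij.1 < ij.2 then (e ⟨ij, h⟩ : ℕ) else 0) = m' := by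
        ext ⟨i, j⟩
        rw [Finsupp.coe_equivFunOnFinite_symm]
        split_ifs with hij
        · rfl
        · exact (Finsupp.filter_apply_neg (fun ij : Fin d × Fin d => ij.1 < ij.2) m (a := (i, j)) hij).symm
      have hfun : evL (monomial m c) = c • fam e := by
        funext u
        rw [Pi.smul_apply, evL_apply, hpt u, if_pos hcond, smul_eq_mul]
        show _ = c * evL _ u
        rw [evL_apply, hme, eval_monomial, eval_monomial, one_mul]
      rw [hfun]
      exact F₀.smul_mem c (Submodule.subset_span ⟨e, rfl⟩)
    · have hzero : evL (monomial m c) = 0 := by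
        funext u; rw [evL_apply, hpt u, if_neg hcond]; rfl
      rw [hzero]; exact F₀.zero_mem
  have hevL : ∀ p : MvPolynomial (Fin d × Fin d) ℂ, weightedTotalDegree w p ≤ s → evL p ∈ F₀ := by
    intro p hp
    rw [p.as_sum, map_sum]
    refine F₀.sum_mem fun m hm => hmono m _ ((le_weightedTotalDegree w hm).trans hp)
  have hFle : F ≤ F₀ := Submodule.span_le.mpr (by rintro f ⟨p, hp, rfl⟩; exact hevL p hp)
  haveI : FiniteDimensional ℂ F := Submodule.finiteDimensional_of_le hFle
  -- two-sided translation stability of `F` (the landed `stub_recenter`)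
  have htrans : ∀ (g h : U), ∀ f ∈ F, (fun m : U => f (g⁻¹ * m * h)) ∈ F := by
    intro g h f hf
    let T : (U → ℂ) →ₗ[ℂ] (U → ℂ) := LinearMap.funLeft ℂ ℂ fun m : U => g⁻¹ * m * h
    have hT : ∀ q : U → ℂ, T q = fun m => q (g⁻¹ * m * h) := fun q => rfl
    rw [← hT]
    have hmap : F.map T ≤ F := by
      rw [Submodule.map_span, Submodule.span_le]
      rintro _ ⟨f', ⟨p, hp, rfl⟩, rfl⟩
      obtain ⟨p', hp'deg, hp'val⟩ :=
        stub_recenter d (g : Matrix.SpecialLinearGroup (Fin d) ℤ) (h : Matrix.SpecialLinearGroup (Fin d) ℤ)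
          g.2 h.2 p
      refine Submodule.subset_span ⟨p', hp'deg.trans hp, ?_⟩
      funext m
      show MvPolynomial.eval (pt (g⁻¹ * m * h)) p = MvPolynomial.eval (pt m) p'
      rw [show MvPolynomial.eval (pt m) p' = _ from hp'val (m : Matrix.SpecialLinearGroup (Fin d) ℤ)]
      have harg : pt (g⁻¹ * m * h) = fun ij : Fin d × Fin d =>
          ((((g : Matrix.SpecialLinearGroup (Fin d) ℤ)⁻¹ * (m : Matrix.SpecialLinearGroup (Fin d) ℤ) *
            (h : Matrix.SpecialLinearGroup (Fin d) ℤ) :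
            Matrix.SpecialLinearGroup (Fin d) ℤ) : Matrix (Fin d) (Fin d) ℤ) ij.1 ij.2 : ℂ) := by
        funext ij; simp only [pt, Subgroup.coe_mul, Subgroup.coe_inv]
      rw [harg]
    exact hmap (Submodule.mem_map_of_mem hf)
  have hL : ∀ x₀ ∈ X', ∀ y ∈ Y', ∀ f ∈ F, (fun m => f (x₀ * y⁻¹ * m)) ∈ F := by
    intro x₀ _ y _ f hf
    have h1 := htrans (y * x₀⁻¹) 1 f hf
    convert h1 using 2 with m
    congr 1
    group
  have hR : ∀ y' ∈ Y', ∀ z₀ ∈ Z', ∀ f ∈ F, (fun m => f (m * (y' * z₀⁻¹))) ∈ F := by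
    intro y' _ z₀ _ f hf
    have h1 := htrans 1 (y' * z₀⁻¹) f hf
    convert h1 using 2 with m
    congr 1
    group
  -- separation inside `U`
  have hsep' : ∀ x₀ ∈ X', ∀ z₀ ∈ Z', ∃ f ∈ F, ∀ x ∈ X', ∀ y ∈ Y', ∀ y' ∈ Y', ∀ z ∈ Z',
      f (x * y⁻¹ * y' * z⁻¹) = if x = x₀ ∧ y = y' ∧ z = z₀ then 1 else 0 := by
    intro x₀ hx₀ z₀ hz₀
    rw [Finset.mem_subtype] at hx₀ hz₀
    obtain ⟨p, hpdeg, hpval⟩ := hsep _ hx₀ _ hz₀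
    refine ⟨evL p, Submodule.subset_span ⟨p, hpdeg, rfl⟩, ?_⟩
    intro x hx y hy y' hy' z hz
    rw [Finset.mem_subtype] at hx hy hy' hz
    rw [evL_apply]
    have hpt : pt (x * y⁻¹ * y' * z⁻¹) = fun ij : Fin d × Fin d =>
        ((((x : Matrix.SpecialLinearGroup (Fin d) ℤ) * (y : Matrix.SpecialLinearGroup (Fin d) ℤ)⁻¹ * y' *
          (z : Matrix.SpecialLinearGroup (Fin d) ℤ)⁻¹ : Matrix.SpecialLinearGroup (Fin d) ℤ) :
            Matrix (Fin d) (Fin d) ℤ) ij.1 ij.2 : ℂ) := by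
      funext ij; simp only [pt, Subgroup.coe_mul, Subgroup.coe_inv]
    rw [hpt, hpval _ hx _ hy _ hy' _ hz]
    simp only [Subtype.ext_iff]
  -- the abstract packing bound, then the dimension count
  have hcap := card_sq_le_finrank_cube_of_separating F X' Y' Z' hL hR hsep'
  have hD : Fintype.card {ij : Fin d × Fin d // ij.1 < ij.2} = d * (d - 1) / 2 := by
    rw [Fintype.card_subtype, Finset.card_filter, Fintype.sum_prod_type]
    have hrow : ∀ i : Fin d, (∑ j : Fin d, if i < j then 1 else 0) = d - 1 - (i : ℕ) := by
      intro i
      rw [← Finset.card_filter]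
      have hIoi : (Finset.univ.filter fun j : Fin d => i < j) = Finset.Ioi i := by
        ext j; simp [Finset.mem_Ioi]
      rw [hIoi, Fin.card_Ioi]
    simp_rw [hrow]
    rw [Fin.sum_univ_eq_sum_range (fun k => d - 1 - k) d, Finset.sum_range_reflect (fun k => k) d,
      Finset.sum_range_id]
  have hdim : Module.finrank ℂ F ≤ (s + 1) ^ (d * (d - 1) / 2) := by
    refine (Submodule.finrank_mono hFle).trans ?_
    have h := finrank_range_le_card (R := ℂ) fam
    simp only [Set.finrank, Fintype.card_fun, Fintype.card_fin, hD] at h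
    exact h
  rw [hX', hY', hZ'] at hcap
  exact hcap.trans (Nat.pow_le_pow_left hdim 3)

end Summit.MatrixMultiplication.MatrixMultiplication.Theorems.NilpotentThresholdDesigns
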